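import Mathlib.MeasureTheory.Integral.Prod
import Mathlib.MeasureTheory.Integral.DominatedConvergence
import Mathlib.Analysis.SpecialFunctions.Trigonometric.Series
import Mathlib.Analysis.SpecialFunctions.Exponential
import HarnessLib

/-!
# Positive kernels and truncated power series (toolkit for Ginibre's inequality)

Elementary ingredients of Ginibre's proof of the general Griffiths inequalities
(J. Ginibre, *General formulation of Griffiths' inequalities*, Comm. Math. Phys. 16 (1970)
310–328), isolated from the group-theoretic part (`GinibreInequality.lean`):

* `IsPosKernel k`: `k(x, y) = ∑ᵢ cᵢ Gᵢ(x) Gᵢ(y)` with `cᵢ ≥ 0`, `Gᵢ` continuous — a convex cone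
  of symmetric kernels closed under products, sums and powers (`IsPosKernel.add/mul/sum/pow`),
  with `∫∫ k d(μ ⊗ μ) = ∑ᵢ cᵢ (∫ Gᵢ dμ)² ≥ 0` (`IsPosKernel.integral_nonneg`, Fubini);
* partial sums `sinhTrunc N`, `expTrunc N` of the power series of `sinh` and `exp`
  (non-negative coefficients), their convergence, uniform bounds, and the fact that
  `sinhTrunc N ∘ k`, `expTrunc N ∘ k` are positive kernels when `k` is;
* the Fubini expansion `∫∫ (f(x) − f(y))(u(x) − u(y)) w(x) w(y) = 2[(∫ fwu)(∫ w) − (∫ fw)(∫ wu)]`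
  (`integral_sub_mul_sub_mul`), the "duplicated system" form of a covariance difference.

Everything here is [folklore]-level real analysis on a compact metrisable space with a finite
measure; no definition of lattice models is made.
-/

noncomputable section

open MeasureTheory Filter Finset
open scoped Topology BigOperators

namespace Literature.Probability.LatticeModels

/-! ### Integrability of continuous functions on compact spaces -/

section Helper

variable {X : Type*} [TopologicalSpace X] [CompactSpace X] [MeasurableSpace X]
  [OpensMeasurableSpace X]

/-- A continuous real function on a compact space is integrable for every finite measure.
[folklore] -/
theorem integrable_of_continuous_compactSpace (ν : Measure X) [IsFiniteMeasure ν] {g : X → ℝ}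
    (hg : Continuous g) : Integrable g ν := by
  obtain ⟨C, hC⟩ := isCompact_univ.exists_bound_of_continuousOn hg.continuousOn
  exact Integrable.of_bound hg.aestronglyMeasurable C
    (ae_of_all _ fun x => hC x (Set.mem_univ x))

end Helper

/-! ### Positive kernels: non-negative combinations of rank-one symmetric kernels -/

section PosKernel

variable {Ω : Type*} [TopologicalSpace Ω]

/-- `k : Ω × Ω → ℝ` is a *positive kernel* in the elementary sense used in Ginibre's proof: a
finite combination `k(x, y) = ∑ᵢ cᵢ Gᵢ(x) Gᵢ(y)` with `cᵢ ≥ 0` and continuous `Gᵢ`. Such kernels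
form a convex cone closed under products, and `∫∫ k d(μ ⊗ μ) = ∑ᵢ cᵢ (∫ Gᵢ dμ)² ≥ 0`
(Ginibre 1970, proof of the main theorem). [folklore] -/
def IsPosKernel (k : Ω × Ω → ℝ) : Prop :=
  ∃ (κ : Type) (_ : Fintype κ) (c : κ → ℝ) (G : κ → Ω → ℝ),
    (∀ i, 0 ≤ c i) ∧ (∀ i, Continuous (G i)) ∧ k = fun p => ∑ i, c i * (G i p.1 * G i p.2)

/-- A rank-one symmetric kernel `G(x) G(y)` is a positive kernel. [folklore] -/
theorem isPosKernel_mul_self {G : Ω → ℝ} (hG : Continuous G) :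
    IsPosKernel (fun p : Ω × Ω => G p.1 * G p.2) :=
  ⟨Unit, inferInstance, fun _ => 1, fun _ => G, fun _ => zero_le_one, fun _ => hG,
    funext fun p => by simp⟩

/-- The constant kernel `a ≥ 0` is a positive kernel. [folklore] -/
theorem isPosKernel_const {a : ℝ} (ha : 0 ≤ a) : IsPosKernel (fun _ : Ω × Ω => a) :=
  ⟨Unit, inferInstance, fun _ => a, fun _ _ => 1, fun _ => ha, fun _ => continuous_const,
    funext fun p => by simp⟩

/-- Positive kernels are closed under addition. [folklore] -/
theorem IsPosKernel.add {k k' : Ω × Ω → ℝ} (hk : IsPosKernel k) (hk' : IsPosKernel k') :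
    IsPosKernel (k + k') := by
  obtain ⟨κ, _, c, G, hc, hG, rfl⟩ := hk
  obtain ⟨κ', _, c', G', hc', hG', rfl⟩ := hk'
  refine ⟨κ ⊕ κ', inferInstance, Sum.elim c c', Sum.elim G G', ?_, ?_, funext fun p => ?_⟩
  · rintro (i | i) <;> simp [hc, hc']
  · rintro (i | i) <;> simp [hG, hG']
  · simp [Fintype.sum_sum_type]

/-- Positive kernels are closed under multiplication (`GᵢG'ⱼ(x) · GᵢG'ⱼ(y)`). [folklore] -/
theorem IsPosKernel.mul {k k' : Ω × Ω → ℝ} (hk : IsPosKernel k) (hk' : IsPosKernel k') :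
    IsPosKernel (k * k') := by
  obtain ⟨κ, _, c, G, hc, hG, rfl⟩ := hk
  obtain ⟨κ', _, c', G', hc', hG', rfl⟩ := hk'
  refine ⟨κ × κ', inferInstance, fun ij => c ij.1 * c' ij.2, fun ij x => G ij.1 x * G' ij.2 x,
    fun ij => mul_nonneg (hc _) (hc' _), fun ij => (hG _).mul (hG' _), funext fun p => ?_⟩
  simp only [Pi.mul_apply, Fintype.sum_prod_type, Finset.sum_mul_sum]
  refine Finset.sum_congr rfl fun i _ => Finset.sum_congr rfl fun j _ => ?_
  ring

/-- Positive kernels are closed under multiplication by non-negative scalars. [folklore] -/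
theorem IsPosKernel.const_mul {k : Ω × Ω → ℝ} (hk : IsPosKernel k) {a : ℝ} (ha : 0 ≤ a) :
    IsPosKernel (fun p => a * k p) := by
  have : (fun p => a * k p) = (fun _ : Ω × Ω => a) * k := rfl
  rw [this]
  exact (isPosKernel_const ha).mul hk

/-- Positive kernels are closed under finite sums. [folklore] -/
theorem IsPosKernel.sum {α : Type*} {s : Finset α} {k : α → Ω × Ω → ℝ}
    (h : ∀ a ∈ s, IsPosKernel (k a)) : IsPosKernel (∑ a ∈ s, k a) := by
  classical
  induction s using Finset.induction_on with
  | empty => rw [Finset.sum_empty]; exact isPosKernel_const (Ω := Ω) le_rfl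
  | insert a s has ih =>
    rw [Finset.sum_insert has]
    exact (h a (Finset.mem_insert_self a s)).add (ih fun b hb => h b (Finset.mem_insert_of_mem hb))

/-- Positive kernels are closed under powers. [folklore] -/
theorem IsPosKernel.pow {k : Ω × Ω → ℝ} (hk : IsPosKernel k) (n : ℕ) : IsPosKernel (k ^ n) := by
  induction n with
  | zero => rw [pow_zero]; exact isPosKernel_const (Ω := Ω) zero_le_one
  | succ n ih => rw [pow_succ]; exact ih.mul hk

/-- A positive kernel is continuous. [folklore] -/
theorem IsPosKernel.continuous {k : Ω × Ω → ℝ} (hk : IsPosKernel k) : Continuous k := by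
  obtain ⟨κ, _, c, G, -, hG, rfl⟩ := hk
  exact continuous_finsetSum _ fun i _ =>
    continuous_const.mul (((hG i).comp continuous_fst).mul ((hG i).comp continuous_snd))

variable [CompactSpace Ω] [SecondCountableTopology Ω] [MeasurableSpace Ω] [BorelSpace Ω]

/-- **Positivity of positive kernels**: `∫∫ k d(μ ⊗ μ) = ∑ᵢ cᵢ (∫ Gᵢ dμ)² ≥ 0` for a finite
measure `μ` on a compact space (Fubini). [folklore] -/
theorem IsPosKernel.integral_nonneg {k : Ω × Ω → ℝ} (hk : IsPosKernel k) (μ : Measure Ω)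
    [IsFiniteMeasure μ] : 0 ≤ ∫ p, k p ∂(μ.prod μ) := by
  obtain ⟨κ, _, c, G, hc, hG, rfl⟩ := hk
  have hint : ∀ i, Integrable (fun p : Ω × Ω => c i * (G i p.1 * G i p.2)) (μ.prod μ) :=
    fun i => integrable_of_continuous_compactSpace _
      (continuous_const.mul (((hG i).comp continuous_fst).mul ((hG i).comp continuous_snd)))
  rw [integral_finsetSum _ fun i _ => hint i]
  refine Finset.sum_nonneg fun i _ => ?_
  rw [integral_const_mul, integral_prod_mul]
  exact mul_nonneg (hc i) (mul_self_nonneg _)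

/-- **The duplicated-system expansion** (Fubini): for continuous `f, u, w` and a finite measure,
`∫∫ (f(x) − f(y))(u(x) − u(y)) w(x) w(y) d(μ ⊗ μ) = 2[(∫ f w u)(∫ w) − (∫ f w)(∫ w u)]`,
Ginibre's way of writing `Z² (⟨fu⟩ − ⟨f⟩⟨u⟩)`-type differences as double integrals. [folklore] -/
theorem integral_sub_mul_sub_mul (μ : Measure Ω) [IsFiniteMeasure μ] {f u w : Ω → ℝ}
    (hf : Continuous f) (hu : Continuous u) (hw : Continuous w) :
    ∫ p, (f p.1 - f p.2) * (u p.1 - u p.2) * (w p.1 * w p.2) ∂(μ.prod μ) =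
      2 * ((∫ x, f x * (w x * u x) ∂μ) * (∫ x, w x ∂μ) -
        (∫ x, f x * w x ∂μ) * (∫ x, w x * u x ∂μ)) := by
  have e : (fun p : Ω × Ω => (f p.1 - f p.2) * (u p.1 - u p.2) * (w p.1 * w p.2)) =
      fun p => f p.1 * (w p.1 * u p.1) * w p.2 - f p.1 * w p.1 * (w p.2 * u p.2) -
        w p.1 * u p.1 * (f p.2 * w p.2) + w p.1 * (f p.2 * (w p.2 * u p.2)) := by
    funext p; ring
  have c1 : Continuous fun p : Ω × Ω => f p.1 * (w p.1 * u p.1) * w p.2 := by fun_prop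
  have c2 : Continuous fun p : Ω × Ω => f p.1 * w p.1 * (w p.2 * u p.2) := by fun_prop
  have c3 : Continuous fun p : Ω × Ω => w p.1 * u p.1 * (f p.2 * w p.2) := by fun_prop
  have c4 : Continuous fun p : Ω × Ω => w p.1 * (f p.2 * (w p.2 * u p.2)) := by fun_prop
  have i1 := integrable_of_continuous_compactSpace (μ.prod μ) c1
  have i2 := integrable_of_continuous_compactSpace (μ.prod μ) c2
  have i3 := integrable_of_continuous_compactSpace (μ.prod μ) c3
  have i4 := integrable_of_continuous_compactSpace (μ.prod μ) c4
  have s1 : ∫ p, (f p.1 * (w p.1 * u p.1) * w p.2 - f p.1 * w p.1 * (w p.2 * u p.2) -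
        w p.1 * u p.1 * (f p.2 * w p.2) + w p.1 * (f p.2 * (w p.2 * u p.2))) ∂(μ.prod μ) =
      (∫ p, (f p.1 * (w p.1 * u p.1) * w p.2 - f p.1 * w p.1 * (w p.2 * u p.2) -
        w p.1 * u p.1 * (f p.2 * w p.2)) ∂(μ.prod μ)) +
        ∫ p, w p.1 * (f p.2 * (w p.2 * u p.2)) ∂(μ.prod μ) :=
    integral_add ((i1.sub i2).sub i3) i4
  have s2 : ∫ p, (f p.1 * (w p.1 * u p.1) * w p.2 - f p.1 * w p.1 * (w p.2 * u p.2) -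
        w p.1 * u p.1 * (f p.2 * w p.2)) ∂(μ.prod μ) =
      (∫ p, (f p.1 * (w p.1 * u p.1) * w p.2 - f p.1 * w p.1 * (w p.2 * u p.2)) ∂(μ.prod μ)) -
        ∫ p, w p.1 * u p.1 * (f p.2 * w p.2) ∂(μ.prod μ) :=
    integral_sub (i1.sub i2) i3
  have s3 : ∫ p, (f p.1 * (w p.1 * u p.1) * w p.2 - f p.1 * w p.1 * (w p.2 * u p.2)) ∂(μ.prod μ) =
      (∫ p, f p.1 * (w p.1 * u p.1) * w p.2 ∂(μ.prod μ)) -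
        ∫ p, f p.1 * w p.1 * (w p.2 * u p.2) ∂(μ.prod μ) :=
    integral_sub i1 i2
  have p1 : ∫ p, f p.1 * (w p.1 * u p.1) * w p.2 ∂(μ.prod μ) =
      (∫ x, f x * (w x * u x) ∂μ) * ∫ y, w y ∂μ :=
    integral_prod_mul (fun x => f x * (w x * u x)) (fun y => w y)
  have p2 : ∫ p, f p.1 * w p.1 * (w p.2 * u p.2) ∂(μ.prod μ) =
      (∫ x, f x * w x ∂μ) * ∫ y, w y * u y ∂μ :=
    integral_prod_mul (fun x => f x * w x) (fun y => w y * u y)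
  have p3 : ∫ p, w p.1 * u p.1 * (f p.2 * w p.2) ∂(μ.prod μ) =
      (∫ x, w x * u x ∂μ) * ∫ y, f y * w y ∂μ :=
    integral_prod_mul (fun x => w x * u x) (fun y => f y * w y)
  have p4 : ∫ p, w p.1 * (f p.2 * (w p.2 * u p.2)) ∂(μ.prod μ) =
      (∫ x, w x ∂μ) * ∫ y, f y * (w y * u y) ∂μ :=
    integral_prod_mul (fun x => w x) (fun y => f y * (w y * u y))
  rw [e, s1, s2, s3, p1, p2, p3, p4]
  ring

end PosKernel

/-! ### Truncated power series of `sinh` and `exp` -/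

section Trunc

variable {Ω : Type*} [TopologicalSpace Ω]

/-- Partial sums of the power series of `sinh` (odd powers, coefficients `1/(2n+1)! ≥ 0`).
[folklore] -/
def sinhTrunc (N : ℕ) (x : ℝ) : ℝ :=
  ∑ n ∈ Finset.range N, x ^ (2 * n + 1) / (Nat.factorial (2 * n + 1) : ℝ)

/-- Partial sums of the power series of `exp` (coefficients `1/n! ≥ 0`). [folklore] -/
def expTrunc (N : ℕ) (x : ℝ) : ℝ :=
  ∑ n ∈ Finset.range N, x ^ n / (Nat.factorial n : ℝ)

/-- The power series of `Real.exp` (Mathlib's `NormedSpace.expSeries_div_hasSum_exp`). [folklore] -/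
theorem hasSum_exp_real (x : ℝ) : HasSum (fun n => x ^ n / (Nat.factorial n : ℝ)) (Real.exp x) := by
  rw [Real.exp_eq_exp_ℝ]
  exact NormedSpace.expSeries_div_hasSum_exp x

/-- `sinhTrunc N x → sinh x`. [folklore] -/
theorem tendsto_sinhTrunc (x : ℝ) : Tendsto (fun N => sinhTrunc N x) atTop (𝓝 (Real.sinh x)) :=
  (Real.hasSum_sinh x).tendsto_sum_nat

/-- `expTrunc N x → exp x`. [folklore] -/
theorem tendsto_expTrunc (x : ℝ) : Tendsto (fun N => expTrunc N x) atTop (𝓝 (Real.exp x)) :=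
  (hasSum_exp_real x).tendsto_sum_nat

/-- `|sinhTrunc N x| ≤ sinh M` for `|x| ≤ M`. [folklore] -/
theorem abs_sinhTrunc_le {x M : ℝ} (hM : |x| ≤ M) (N : ℕ) : |sinhTrunc N x| ≤ Real.sinh M := by
  have hM0 : 0 ≤ M := (abs_nonneg x).trans hM
  calc |sinhTrunc N x|
      ≤ ∑ n ∈ Finset.range N, |x ^ (2 * n + 1) / (Nat.factorial (2 * n + 1) : ℝ)| :=
        Finset.abs_sum_le_sum_abs _ _
    _ ≤ ∑ n ∈ Finset.range N, M ^ (2 * n + 1) / (Nat.factorial (2 * n + 1) : ℝ) :=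
        Finset.sum_le_sum fun n _ => by
          rw [abs_div, abs_pow, Nat.abs_cast]
          gcongr
    _ ≤ Real.sinh M :=
        sum_le_hasSum (Finset.range N) (fun n _ => by positivity) (Real.hasSum_sinh M)

/-- `|expTrunc N x| ≤ exp M` for `|x| ≤ M`. [folklore] -/
theorem abs_expTrunc_le {x M : ℝ} (hM : |x| ≤ M) (N : ℕ) : |expTrunc N x| ≤ Real.exp M := by
  have hM0 : 0 ≤ M := (abs_nonneg x).trans hM
  calc |expTrunc N x| ≤ ∑ n ∈ Finset.range N, |x ^ n / (Nat.factorial n : ℝ)| :=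
        Finset.abs_sum_le_sum_abs _ _
    _ ≤ ∑ n ∈ Finset.range N, M ^ n / (Nat.factorial n : ℝ) :=
        Finset.sum_le_sum fun n _ => by
          rw [abs_div, abs_pow, Nat.abs_cast]
          gcongr
    _ ≤ Real.exp M := sum_le_hasSum (Finset.range N) (fun n _ => by positivity) (hasSum_exp_real M)

/-- `sinhTrunc N ∘ k` is a positive kernel if `k` is (odd powers, non-negative coefficients).
[folklore] -/
theorem IsPosKernel.comp_sinhTrunc {k : Ω × Ω → ℝ} (hk : IsPosKernel k) (N : ℕ) :
    IsPosKernel (fun p => sinhTrunc N (k p)) := by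
  have : (fun p => sinhTrunc N (k p)) =
      ∑ n ∈ Finset.range N, fun p => ((Nat.factorial (2 * n + 1) : ℕ) : ℝ)⁻¹ * (k ^ (2 * n + 1)) p := by
    funext p; simp only [sinhTrunc, Finset.sum_apply, Pi.pow_apply, div_eq_inv_mul]
  rw [this]
  exact IsPosKernel.sum fun n _ => (hk.pow _).const_mul (inv_nonneg.2 (Nat.cast_nonneg _))

/-- `expTrunc N ∘ k` is a positive kernel if `k` is. [folklore] -/
theorem IsPosKernel.comp_expTrunc {k : Ω × Ω → ℝ} (hk : IsPosKernel k) (N : ℕ) :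
    IsPosKernel (fun p => expTrunc N (k p)) := by
  have : (fun p => expTrunc N (k p)) =
      ∑ n ∈ Finset.range N, fun p => ((Nat.factorial n : ℕ) : ℝ)⁻¹ * (k ^ n) p := by
    funext p; simp only [expTrunc, Finset.sum_apply, Pi.pow_apply, div_eq_inv_mul]
  rw [this]
  exact IsPosKernel.sum fun n _ => (hk.pow _).const_mul (inv_nonneg.2 (Nat.cast_nonneg _))

end Trunc

end Literature.Probability.LatticeModels
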